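import Literature.Computability.AlgebraicComplexity.NonscalarBaurStrassen
import Literature.Computability.AlgebraicComplexity.NonscalarBilinearRank
import Literature.Computability.AlgebraicComplexity.MatrixMultiplicationExponent
import HarnessLib

/-!
# Baur–Strassen: tensor rank is bounded by the circuit complexity of the trilinear form

Topic `Computability/AlgebraicComplexity`, namespace `Literature.Computability.AlgebraicComplexity`.

W. Baur, V. Strassen, *The complexity of partial derivatives*, Theoret. Comput. Sci. 22 (1983),
Thm. 1 (all first partials at three times the cost), as rendered in P. Bürgisser, M. Clausen,
M. A. Shokrollahi, *Algebraic Complexity Theory* (1997), Thm. (7.7), together with the rank bound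
`R ≤ 2 · L^{ns}` for sets of bilinear forms, BCS 1997 Prop. (14.1) with (14.8), and `L^{ns} ≤ L`,
BCS 1997 (4.7).  Printed consequence (BCS 1997, Ch. 14 discussion after (14.8); Bläser 2013, §4): the
tensor rank `R(t)` of a tensor `t ∈ R^{ι×ι×ι}` is at most a constant times the (fan-in-two) circuit
complexity of the associated trilinear form `F_t = Σ_{i,j,l} t(i,j,l) X_(0,i) X_(1,j) X_(2,l)`.

TYPED VS PRINTED: we prove the explicit constant `6 = 2 · 3` over an ARBITRARY commutative ring `R`
(`tensorRank_le_six_mul_complexity`): `L^{ns}(F_t) ≤ L(F_t)` (tree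
`exists_isNonscalarSeq_length_le_complexity`), all partials `∂F_t/∂X_(0,i)` jointly with `≤ 3 L(F_t)`
nonscalar steps (tree `exists_isNonscalarSeq_forall_pderiv`), and the bilinear-coefficient tensor of
that family is a sum of `≤ 2 · 3 L(F_t)` triads (tree `exists_triads_of_isNonscalarSeq`); the one new
calculation is the coefficient identity `coeff_{X_(1,j) X_(2,l)} ∂F_t/∂X_(0,i) = t(i,j,l)`
(`coeff_pderiv_trilinear`).  The specialisation to `ℂ` is the registered stub `stub_rankLeComplexity`
of `Summits/ValiantsHypothesis/…/Cruxes/TripartitionHard/Lines/birth.lean`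
(`Theorems/RyserTripartitionTripartitionHardStubRankLeComplexity.lean`).  Honest framing: a classical
upper-bound transfer; no lower bound is proved here; `VP ≠ VNP` is NOT proved.  Everything is proved;
no named facts, no definitions.
-/

noncomputable section

namespace Literature.Computability.AlgebraicComplexity

open MvPolynomial

universe u

/-! ### The bilinear coefficients of the partials of a trilinear form -/

/-- The monomial form of one term `c · X_(0,i) X_(1,j) X_(2,l)` of a trilinear form.
[cite: BurgisserClausenShokrollahi1997, (14.8)] -/
theorem trilinearTerm_eq_monomial {R : Type u} [CommSemiring R] {ι : Type} (c : R) (i j l : ι) :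
    (MvPolynomial.C c * MvPolynomial.X (0, i) * MvPolynomial.X (1, j) * MvPolynomial.X (2, l) :
      MvPolynomial (Fin 3 × ι) R) =
      monomial (Finsupp.single ((0 : Fin 3), i) 1 + Finsupp.single ((1 : Fin 3), j) 1 +
        Finsupp.single ((2 : Fin 3), l) 1) c := by
  rw [C_mul_X_eq_monomial, X, X, monomial_mul, monomial_mul, mul_one, mul_one]

/-- The bilinear coefficient `coeff_{X_(1,a) X_(2,b)} ∂/∂X_(0,o)` of one term
`c · X_(0,i) X_(1,j) X_(2,l)` is `c` if `(i,j,l) = (o,a,b)` and `0` otherwise.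
[cite: BurgisserClausenShokrollahi1997, (14.8)] -/
theorem coeff_pderiv_trilinearTerm {R : Type u} [CommSemiring R] {ι : Type} [DecidableEq ι] (c : R)
    (i j l o a b : ι) :
    MvPolynomial.coeff (Finsupp.single ((1 : Fin 3), a) 1 + Finsupp.single ((2 : Fin 3), b) 1)
      (MvPolynomial.pderiv ((0 : Fin 3), o)
        (MvPolynomial.C c * MvPolynomial.X (0, i) * MvPolynomial.X (1, j) * MvPolynomial.X (2, l) :
          MvPolynomial (Fin 3 × ι) R)) =
      if i = o ∧ j = a ∧ l = b then c else 0 := by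
  classical
  rw [trilinearTerm_eq_monomial, pderiv_monomial, coeff_monomial]
  -- the exponent of `X_(0,o)` in the term
  have hexp : (Finsupp.single ((0 : Fin 3), i) 1 + Finsupp.single ((1 : Fin 3), j) 1 +
      Finsupp.single ((2 : Fin 3), l) 1 : Fin 3 × ι →₀ ℕ) (0, o) = if i = o then 1 else 0 := by
    simp only [Finsupp.add_apply, Finsupp.single_apply, Prod.mk.injEq, true_and]
    have h1 : ¬ ((1 : Fin 3) = 0 ∧ j = o) := fun h => absurd h.1 (by decide)
    have h2 : ¬ ((2 : Fin 3) = 0 ∧ l = o) := fun h => absurd h.1 (by decide)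
    rw [if_neg h1, if_neg h2, add_zero, add_zero]
  by_cases hio : i = o
  · subst hio
    have hsub : (Finsupp.single ((0 : Fin 3), i) 1 + Finsupp.single ((1 : Fin 3), j) 1 +
        Finsupp.single ((2 : Fin 3), l) 1 : Fin 3 × ι →₀ ℕ) - Finsupp.single ((0 : Fin 3), i) 1 =
        Finsupp.single ((1 : Fin 3), j) 1 + Finsupp.single ((2 : Fin 3), l) 1 := by
      rw [add_assoc, add_tsub_cancel_left]
    rw [hexp, if_pos rfl, hsub, Nat.cast_one, mul_one]
    simp only [true_and]
    by_cases hjl : j = a ∧ l = b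
    · obtain ⟨rfl, rfl⟩ := hjl
      rw [if_pos rfl, if_pos ⟨rfl, rfl⟩]
    · rw [if_neg hjl, if_neg]
      intro heq
      apply hjl
      rw [Finsupp.single_add_single_eq_single_add_single one_ne_zero one_ne_zero] at heq
      rcases heq with ⟨h1, h2⟩ | ⟨-, h1, -⟩ | ⟨h0, -, -⟩
      · exact ⟨(Prod.mk.inj h1).2, (Prod.mk.inj h2).2⟩
      · exact absurd (Prod.mk.inj h1).1 (by decide)
      · exact absurd h0 (by decide)
  · rw [hexp, if_neg hio, Nat.cast_zero, mul_zero]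
    have hfalse : ¬ (i = o ∧ j = a ∧ l = b) := fun h => hio h.1
    rw [if_neg hfalse]
    split_ifs <;> rfl

/-- **Coefficient identity.** For the trilinear form `F_t = Σ t(i,j,l) X_(0,i) X_(1,j) X_(2,l)`:
`coeff_{X_(1,a) X_(2,b)} (∂F_t/∂X_(0,o)) = t(o,a,b)` — the bilinear forms `∂F_t/∂X_(0,o)` have
coefficient tensor `t`. [cite: BurgisserClausenShokrollahi1997, (14.8)] -/
theorem coeff_pderiv_trilinear {R : Type u} [CommSemiring R] {ι : Type} [Fintype ι]
    (t : ι → ι → ι → R) (o a b : ι) :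
    MvPolynomial.coeff (Finsupp.single ((1 : Fin 3), a) 1 + Finsupp.single ((2 : Fin 3), b) 1)
      (MvPolynomial.pderiv ((0 : Fin 3), o)
        (∑ i : ι, ∑ j : ι, ∑ l : ι,
          (MvPolynomial.C (t i j l) * MvPolynomial.X (0, i) * MvPolynomial.X (1, j) *
            MvPolynomial.X (2, l) : MvPolynomial (Fin 3 × ι) R))) = t o a b := by
  classical
  simp only [map_sum, coeff_sum, coeff_pderiv_trilinearTerm]
  rw [Finset.sum_eq_single o (fun i _ hi => by simp [hi]) (fun h => absurd (Finset.mem_univ o) h)]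
  rw [Finset.sum_eq_single a (fun j _ hj => by simp [hj]) (fun h => absurd (Finset.mem_univ a) h)]
  rw [Finset.sum_eq_single b (fun l _ hl => by simp [hl]) (fun h => absurd (Finset.mem_univ b) h)]
  simp

/-! ### The rank bound -/

/-- **Baur–Strassen rank-to-circuit bound, explicit constant.** Over any commutative ring `R`, for every
finite index type `ι` and tensor `t : ι → ι → ι → R`, the tensor rank of `t` is at most six times the
fan-in-two circuit complexity of its trilinear form `F_t = Σ_{i,j,l} t(i,j,l) · X_(0,i) X_(1,j) X_(2,l)`
(`6 = 2 · 3`: Baur–Strassen's factor `3` for all partials, BCS (7.7), times the factor `2` of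
`R ≤ 2 L^{ns}`, BCS (14.1)/(14.8); `L^{ns} ≤ L`, BCS (4.7)).
[cite: BaurStrassen1983, Thm. 1] [cite: BurgisserClausenShokrollahi1997, Thm. (7.7), Prop. (14.1)] -/
theorem tensorRank_le_six_mul_complexity {R : Type} [CommRing R] (ι : Type) [Fintype ι]
    (t : ι → ι → ι → R) :
    tensorRank t ≤ 6 * complexity (∑ i : ι, ∑ j : ι, ∑ l : ι,
      (MvPolynomial.C (t i j l) * MvPolynomial.X (0, i) * MvPolynomial.X (1, j) *
        MvPolynomial.X (2, l) : MvPolynomial (Fin 3 × ι) R)) := by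
  classical
  set F : MvPolynomial (Fin 3 × ι) R := ∑ i : ι, ∑ j : ι, ∑ l : ι,
      (MvPolynomial.C (t i j l) * MvPolynomial.X (0, i) * MvPolynomial.X (1, j) *
        MvPolynomial.X (2, l) : MvPolynomial (Fin 3 × ι) R) with hF
  -- (1) a nonscalar computation sequence of length `≤ L(F)` for `F` (BCS (4.7))
  have h1 := exists_isNonscalarSeq_length_le_complexity F
  -- (2) Baur–Strassen: one of length `≤ 3 L(F)` for all the partials
  have h2 := exists_isNonscalarSeq_forall_pderiv h1
  have h3 : ∃ gs : List (MvPolynomial (Fin 3 × ι) R), IsNonscalarSeq gs ∧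
      gs.length ≤ 3 * complexity F ∧
      ∀ o : ι, MvPolynomial.pderiv ((0 : Fin 3), o) F ∈ freeSpan {q | q ∈ gs} := by
    obtain ⟨gs, hns, hlen, hall⟩ := h2
    exact ⟨gs, hns, hlen, fun o => hall (0, o)⟩
  -- (3) `R ≤ 2 L^{ns}` for the bilinear coefficient tensor of the partials
  obtain ⟨r, hr, w, u, v, hwuv⟩ :=
    exists_triads_of_isNonscalarSeq (fun j : ι => ((1 : Fin 3), j)) (fun l : ι => ((2 : Fin 3), l))
      (fun a b h => absurd (Prod.mk.inj h).1 (by decide))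
      (fun o : ι => MvPolynomial.pderiv ((0 : Fin 3), o) F) h3
  -- the coefficient tensor IS `t`
  have ht : t = ∑ ρ, triad (w ρ) (u ρ) (v ρ) := by
    funext o a b
    rw [← coeff_pderiv_trilinear t o a b, ← hF, ← hwuv o a b]
    simp only [Finset.sum_apply, triad_apply]
  calc tensorRank t ≤ r := tensorRank_le_of_eq_sum w u v ht
    _ ≤ 2 * (3 * complexity F) := hr
    _ = 6 * complexity F := by ring

end Literature.Computability.AlgebraicComplexity

end
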